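import Summits.AtomisticToContinuum.Crystallization.Theorems.FrustratedLawDichotomyCellHaloNormal
import Summits.AtomisticToContinuum.Crystallization.Theorems.FrustratedLawDichotomyZoneKernel
import Summits.AtomisticToContinuum.Crystallization.Theorems.FrustratedLawDichotomyZoneFloor
import Summits.AtomisticToContinuum.Crystallization.Theorems.FrustratedLawDichotomyCoherentInhabited

/-!
# FrustratedLawDichotomy · crux `AperiodicFrustratedLawGap` (stmt-AtomisticToContinuum-27623) — THE CLASS-Z CELL FRAME, part I:
# grid-point templates, envelope sets, table dischargers, the Z row set and its INHABITATION WITNESS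
# (ZONE-TRANSPORT class Z; KFILE amendment D FINAL §D1/§D2/§D4/§D6, crit r1865 (B); cell decomp-a2c, lens-5 g114)

A class-Z cell books D-FACING host-like roots: coherent (tolerance `τ`) with a host half-lattice on the halo window
`haloWindow (nL F n₁) (sL F n₁ S) R_W` and with NO marked atom in the zone `‖q‖ ≤ R_Z ∧ sL < ⟪q, nL⟫` (`…ZoneKernel.DFacing`), over a rational grid
of placements `F` (strain box), label normals `n₁` (normal box) and levels `S` (band).  This file is the `(369)`-independent half of the frame:
* §1 ★ THE GRID-POINT TEMPLATE `tplZ Mrad a τ F n₁ S := Mrad.filter (gram(FᵀF)(a z, n₁) + τ·‖F n₁‖ ≤ S)` («exactly below the plane, tube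
  included») — so the plane conjunct `⟪x, n⟫ + τ ≤ s` of the Z floors holds BY CONSTRUCTION (`inner_add_le_sL_of_mem_tplZ`, `hin_image_tplZ`);
  over a normal box of positive width no fixed template can serve (amendment D §D1);
* §2 the decided ENVELOPES `wPlus ⊇ tplZ` (`tplZ_subset_wPlus`) and `kRef ⊆ tplZ ∖ root` (`kRef_subset_tplZ_erase`) from per-label brackets
  `g_lo ≤ gram ≤ g_hi`, `N_lo ≤ ‖F n₁‖ ≤ N_hi`, `r_lo ≤ ‖F a z‖ ≤ r_hi`, and the TABLE DISCHARGERS of the floor hypotheses of `…ZoneFloor`: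
  `hvlo_of_table` (tube floors by `lennardJones_interval_floor`), `hkw_of_table` (refunds by `neg_lennardJones_le_abs_of_one_le`);
* §2b NORMAL BOXES `normalBox c η` with the brackets in CLOSED FORM for the generator: `gram_box_lower`/`gram_box_upper` (`g_lo`, `g_hi`),
  `norm_posL_box_bracket` (`N_lo ≤ ‖F n₁‖ ≤ N_hi`);
* §3 the Z ROW SET `rowZ` / `cellRowZ` (union over the rational grid `gridZ` of `coherentOn ∩ DFacing`), measurable (`measurableSet_cellRowZ`);
* §4 ★★ THE INHABITATION WITNESS (amendment E «inhabitation must be a Lean fact», via (364) `image_mem_coherentOn_of_complete`): the ideal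
  half-crystal `{z adm | gram(a z, n₁) ≤ S}` at a STRADDLE-FREE grid point lies in `coherentOn (tplZ-image) ∩ DFacing` — D-facing VACUOUSLY (every
  atom has `⟪q, nL⟫ ≤ sL`), radial completeness `hcompR` load-bearing (`halfCrystal_mem_coherentOn_inter_dFacing`, `halfCrystal_mem_cellRowZ`);
  straddle-freeness from INTEGER HEIGHTS `gram = λ·(z·m)`, `S = λ(k + ½)`, `τ‖F n₁‖ ≤ λ/2` (`straddleFree_of_intHeights`, `gram_eq_dot_of_mulVec`).
Part II (`…CellZFloorFrame`, on (369) `…ZoneFloorComplete`) carries the generic row floor `rowFloorZ_of_cells'`.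

House conventions: SI units · italic scalars, bold vectors, sans-serif tensors · numbered formulae only when referenced · en-dash for
ranges · References = cited works, numbered, alphabetical · no footnotes; Remarks at section ends · British spelling, -ise · Lennard-Jones
hyphenated; NASH capitalised as the Statement's notion · "folklore" tags standard bookkeeping; no new references are cited in this file.
-/

noncomputable section

namespace Summit.AtomisticToContinuum.Crystallization.Theorems.FrustratedLawDichotomyCellZFrame

open MeasureTheory Metric Set
open scoped BigOperators RealInnerProductSpace
open Literature.MathematicalPhysics.StatisticalMechanics (lennardJones)
open Literature.Probability.Process (IsRootedHardCore count_restrict_singleton_ne_zero_iff)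
open Summit.AtomisticToContinuum.Crystallization.Theorems.ChargedEnergyGapNegative (E3)
open Summit.AtomisticToContinuum.Crystallization.Theorems.FrustratedLawDichotomyCoherentOn (coherentOn measurableSet_coherentOn)
open Summit.AtomisticToContinuum.Crystallization.Theorems.FrustratedLawDichotomyCoherentFloorHalo (haloWindow measurableSet_haloWindow)
open Summit.AtomisticToContinuum.Crystallization.Theorems.FrustratedLawDichotomyCellMetric (posL gram inner_posL posL_zero le_norm_posL)
open Summit.AtomisticToContinuum.Crystallization.Theorems.FrustratedLawDichotomyCellData (gram_ge_nearId)
open Summit.AtomisticToContinuum.Crystallization.Theorems.FrustratedLawDichotomyCellRows (ratBox ratBox_countable mem_ratBox)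
open Summit.AtomisticToContinuum.Crystallization.Theorems.FrustratedLawDichotomyCellHaloNormal
  (nL sL inner_nL_le_sL_iff inner_add_le_sL norm_posL_le_bracket gram_le_dot_add dot_sub_le_gram)
open Summit.AtomisticToContinuum.Crystallization.Theorems.FrustratedLawDichotomyZoneKernel (DFacing measurableSet_dFacing mem_dFacing_of_pointwise)
open Summit.AtomisticToContinuum.Crystallization.Theorems.FrustratedLawDichotomyZoneFloor
  (lennardJones_interval_floor neg_lennardJones_le_abs_of_one_le)
open Summit.AtomisticToContinuum.Crystallization.Theorems.FrustratedLawDichotomyCoherentInhabited (image_mem_coherentOn_of_complete)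

variable {ι : Type*}

/-! LANE EDITION (hand-2 g48, r1868 GO (373)): the 479-line node exceeds the gate's 400-line limit for files with proofs, so it lands as TWO modules
with ONE namespace — this PART A (§1 template, §2 envelopes/table dischargers, §2b normal boxes) and `…CellZFrame` (§3 row set, §4 inhabitation witness),
which imports it.  Declarations, statements and proofs are byte-identical to lens-5's 460bb4dfb3ca8015; only the file boundary is new. -/
/-! ## §1. ★ The grid-point template and the plane conjunct by construction -/

/-- ★ **THE GRID-POINT TEMPLATE of a Z cell**: the radially complete labels `Mrad` EXACTLY BELOW the plane at the grid point `(F, n₁, S)`,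
tube included: `gram(FᵀF)(a z, n₁) + τ·‖F n₁‖ ≤ S`.  (A `Prop` filter; a K-file never evaluates it at a symbolic `F` — it uses `mem_tplZ`,
`tplZ_subset` and the envelopes of §2.) -/
def tplZ (Mrad : Finset ι) (a : ι → Fin 3 → ℝ) (τ : ℝ) (F : Matrix (Fin 3) (Fin 3) ℝ) (n₁ : Fin 3 → ℝ) (S : ℝ) : Finset ι :=
  Mrad.filter fun z => gram (F.transpose * F) (a z) n₁ + τ * ‖posL F n₁‖ ≤ S

section Template

variable {Mrad : Finset ι} {a : ι → Fin 3 → ℝ} {τ : ℝ} {F : Matrix (Fin 3) (Fin 3) ℝ} {n₁ : Fin 3 → ℝ} {S : ℝ}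

/-- Membership in the grid-point template. [folklore] -/
theorem mem_tplZ {z : ι} : z ∈ tplZ Mrad a τ F n₁ S ↔ z ∈ Mrad ∧ gram (F.transpose * F) (a z) n₁ + τ * ‖posL F n₁‖ ≤ S :=
  Finset.mem_filter

/-- The grid-point template is a sub-list of the radially complete labels. [folklore] -/
theorem tplZ_subset : tplZ Mrad a τ F n₁ S ⊆ Mrad := Finset.filter_subset _ _

/-- The template grows with the level. [folklore] -/
theorem tplZ_mono {S' : ℝ} (h : S ≤ S') : tplZ Mrad a τ F n₁ S ⊆ tplZ Mrad a τ F n₁ S' := fun z hz => by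
  rw [mem_tplZ] at hz ⊢
  exact ⟨hz.1, hz.2.trans h⟩

/-- `gram G 0 n = 0`. [folklore] -/
theorem gram_zero_left (G : Matrix (Fin 3) (Fin 3) ℝ) (n : Fin 3 → ℝ) : gram G 0 n = 0 := by
  unfold gram
  simp

/-- The root label (`a o = 0`) is a template point iff `τ·‖F n₁‖ ≤ S` (decided once per cell: `τ·N_hi ≤ S_lo`). [folklore] -/
theorem mem_tplZ_root {o : ι} (ho : o ∈ Mrad) (h0 : a o = 0) (h : τ * ‖posL F n₁‖ ≤ S) : o ∈ tplZ Mrad a τ F n₁ S := by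
  rw [mem_tplZ, h0, gram_zero_left, zero_add]
  exact ⟨ho, h⟩

/-- ★ **THE PLANE CONJUNCT BY CONSTRUCTION**: a template site's tube lies below the placed plane, `⟪F a z, nL⟫ + τ ≤ sL`. [folklore] -/
theorem inner_add_le_sL_of_mem_tplZ (h0 : 0 < ‖posL F n₁‖) (hτ : 0 ≤ τ) {z : ι} (hz : z ∈ tplZ Mrad a τ F n₁ S) :
    ⟪posL F (a z), nL F n₁⟫ + τ ≤ sL F n₁ S :=
  inner_add_le_sL F n₁ h0 le_rfl (a z) le_rfl hτ (mem_tplZ.1 hz).2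

/-- The same over the placed template (the `hin` hypothesis of (369) `floor_transport_of_zoneFloor₁'/₂'`, verbatim). [folklore] -/
theorem hin_image_tplZ (h0 : 0 < ‖posL F n₁‖) (hτ : 0 ≤ τ) :
    ∀ x ∈ (tplZ Mrad a τ F n₁ S).image (fun z => posL F (a z)), ⟪x, nL F n₁⟫ + τ ≤ sL F n₁ S := by
  intro x hx
  obtain ⟨z, hz, rfl⟩ := Finset.mem_image.1 hx
  exact inner_add_le_sL_of_mem_tplZ h0 hτ hz

/-- For K-files: `gram G v n = Σᵢ vᵢ wᵢ` once `G n = w` is decided (integer heights `λ·(z·m)` at a reciprocal normal). [folklore] -/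
theorem gram_eq_dot_of_mulVec {G : Matrix (Fin 3) (Fin 3) ℝ} {n w : Fin 3 → ℝ} (hw : ∀ i, ∑ j, G i j * n j = w i) (v : Fin 3 → ℝ) :
    gram G v n = ∑ i, v i * w i := by
  unfold gram
  refine Finset.sum_congr rfl fun i _ => ?_
  rw [← hw i, Finset.mul_sum]
  exact Finset.sum_congr rfl fun j _ => by ring

end Template

/-! ## §2. The decided envelopes and the table dischargers -/

/-- `W⁺`: labels POSSIBLY below some plane of the cell (`g_lo + τ·N_lo ≤ S_hi`) — a superset of every grid-point template. -/
def wPlus (Mrad : Finset ι) (glo : ι → ℝ) (τ Nlo Shi : ℝ) : Finset ι := Mrad.filter fun z => glo z + τ * Nlo ≤ Shi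

/-- `K`: labels CERTAINLY below every plane of the cell with their tube radially inside `(R_Z + τ, R_W − τ)` — the refund set, a subset of every
grid-point template minus the root. -/
def kRef (Mrad : Finset ι) (ghi rlo rhi : ι → ℝ) (τ Nhi Slo Rz Rw : ℝ) : Finset ι :=
  Mrad.filter fun z => ghi z + τ * Nhi ≤ Slo ∧ Rz + τ < rlo z ∧ rhi z + τ ≤ Rw

section Envelopes

variable {Mrad : Finset ι} {a : ι → Fin 3 → ℝ} {τ : ℝ} {F : Matrix (Fin 3) (Fin 3) ℝ} {n₁ : Fin 3 → ℝ} {S : ℝ}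
variable {glo ghi rlo rhi vlo kw : ι → ℝ} {Nlo Nhi Slo Shi Rz Rw : ℝ} {o : ι}

/-- Membership in `W⁺`. [folklore] -/
theorem mem_wPlus {z : ι} : z ∈ wPlus Mrad glo τ Nlo Shi ↔ z ∈ Mrad ∧ glo z + τ * Nlo ≤ Shi := Finset.mem_filter

/-- `W⁺ ⊆ Mrad`. [folklore] -/
theorem wPlus_subset : wPlus Mrad glo τ Nlo Shi ⊆ Mrad := Finset.filter_subset _ _

/-- Membership in `K`. [folklore] -/
theorem mem_kRef {z : ι} : z ∈ kRef Mrad ghi rlo rhi τ Nhi Slo Rz Rw ↔ z ∈ Mrad ∧ (ghi z + τ * Nhi ≤ Slo ∧ Rz + τ < rlo z ∧ rhi z + τ ≤ Rw) :=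
  Finset.mem_filter

/-- `K ⊆ Mrad`. [folklore] -/
theorem kRef_subset : kRef Mrad ghi rlo rhi τ Nhi Slo Rz Rw ⊆ Mrad := Finset.filter_subset _ _

/-- ★ `tplZ ⊆ W⁺` at every grid point of the cell (`g_lo ≤ gram`, `N_lo ≤ ‖F n₁‖`, `S ≤ S_hi`, `τ ≥ 0`). [folklore] -/
theorem tplZ_subset_wPlus (hτ : 0 ≤ τ) (hglo : ∀ z ∈ Mrad, glo z ≤ gram (F.transpose * F) (a z) n₁) (hN : Nlo ≤ ‖posL F n₁‖)
    (hS : S ≤ Shi) : tplZ Mrad a τ F n₁ S ⊆ wPlus Mrad glo τ Nlo Shi := by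
  intro z hz
  rw [mem_tplZ] at hz
  rw [mem_wPlus]
  refine ⟨hz.1, ?_⟩
  have h1 := hglo z hz.1
  have h2 : τ * Nlo ≤ τ * ‖posL F n₁‖ := mul_le_mul_of_nonneg_left hN hτ
  linarith [hz.2]

/-- ★ `K ⊆ tplZ ∖ root` at every grid point of the cell (`gram ≤ g_hi`, `‖F n₁‖ ≤ N_hi`, `S_lo ≤ S`, `r_lo ≤ ‖F a z‖`, `R_Z ≥ 0`). [folklore] -/
theorem kRef_subset_tplZ_erase [DecidableEq ι] (hτ : 0 ≤ τ) (hRz : 0 ≤ Rz) (hghi : ∀ z ∈ Mrad, gram (F.transpose * F) (a z) n₁ ≤ ghi z)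
    (hN : ‖posL F n₁‖ ≤ Nhi) (hS : Slo ≤ S) (hrlo : ∀ z ∈ Mrad, rlo z ≤ ‖posL F (a z)‖) (h0 : a o = 0) :
    kRef Mrad ghi rlo rhi τ Nhi Slo Rz Rw ⊆ (tplZ Mrad a τ F n₁ S).erase o := by
  intro z hz
  rw [mem_kRef] at hz
  rw [Finset.mem_erase, mem_tplZ]
  refine ⟨?_, hz.1, ?_⟩
  · rintro rfl
    have h1 := hrlo _ hz.1
    rw [h0, posL_zero, norm_zero] at h1
    linarith [hz.2.2.1]
  · have h1 := hghi z hz.1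
    have h2 : τ * ‖posL F n₁‖ ≤ τ * Nhi := mul_le_mul_of_nonneg_left hN hτ
    linarith [hz.2.1]

/-- ★ **(z2) TUBE FLOORS FROM THE TABLE.**  Per-label radial brackets `r_lo ≤ ‖F a z‖ ≤ r_hi` on the cell and the decided endpoint fact
`vlo z ≤ (V(r_hi+τ) if r_hi+τ ≤ 1 | V(r_lo−τ) if 1 ≤ r_lo−τ | −1/12)` give the `hvlo` hypothesis of the Z floors, by unimodality
(`lennardJones_interval_floor`). [folklore] -/
theorem hvlo_of_table (hr : ∀ z ∈ Mrad, rlo z ≤ ‖posL F (a z)‖ ∧ ‖posL F (a z)‖ ≤ rhi z) (hpos : ∀ z ∈ Mrad, z ≠ o → 0 < rlo z - τ)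
    (htab : ∀ z ∈ Mrad, z ≠ o → vlo z ≤
      (if rhi z + τ ≤ 1 then lennardJones (rhi z + τ) else if 1 ≤ rlo z - τ then lennardJones (rlo z - τ) else -1 / 12)) :
    ∀ z ∈ Mrad, z ≠ o → ∀ r : ℝ, ‖posL F (a z)‖ - τ ≤ r → r ≤ ‖posL F (a z)‖ + τ → vlo z ≤ lennardJones r := by
  intro z hz hzo r h1 h2
  have hlo : rlo z - τ ≤ r := by linarith [(hr z hz).1]
  have hhi : r ≤ rhi z + τ := by linarith [(hr z hz).2]
  exact (htab z hz hzo).trans (lennardJones_interval_floor (hpos z hz hzo) hlo hhi)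

/-- ★ **(z3) REFUNDS FROM THE TABLE.**  `kw z > 0` only on `K`, with the decided bound `kw z ≤ −V(r_hi + τ)` (`|V|` is decreasing beyond `1`,
`neg_lennardJones_le_abs_of_one_le`; `R_Z ≥ 1`): the `hkw` hypothesis of (369) `zoneFloor₁'`. [folklore] -/
theorem hkw_of_table (hRz : 1 ≤ Rz) (hr : ∀ z ∈ Mrad, rlo z ≤ ‖posL F (a z)‖ ∧ ‖posL F (a z)‖ ≤ rhi z)
    (htab : ∀ z ∈ Mrad, z ≠ o → 0 < kw z → z ∈ kRef Mrad ghi rlo rhi τ Nhi Slo Rz Rw ∧ kw z ≤ -lennardJones (rhi z + τ)) :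
    ∀ z ∈ Mrad, z ≠ o → 0 < kw z → Rz < ‖posL F (a z)‖ - τ ∧ ‖posL F (a z)‖ + τ ≤ Rw ∧
      ∀ r : ℝ, ‖posL F (a z)‖ - τ ≤ r → r ≤ ‖posL F (a z)‖ + τ → kw z ≤ |lennardJones r| := by
  intro z hz hzo hk
  obtain ⟨hK, hle⟩ := htab z hz hzo hk
  rw [mem_kRef] at hK
  obtain ⟨-, -, hK1, hK2⟩ := hK
  have hrz := hr z hz
  refine ⟨by linarith [hrz.1], by linarith [hrz.2], fun r hr1 hr2 => hle.trans ?_⟩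
  exact neg_lennardJones_le_abs_of_one_le (lo := rlo z - τ) (by linarith) (by linarith [hrz.1]) (by linarith [hrz.2])

/-- (z1)-type monotonicity: with all off-root floors `≤ 0` on `W⁺`, the sum over any sub-template dominates the sum over `W⁺`. [folklore] -/
theorem sum_erase_le_of_subset_of_nonpos [DecidableEq ι] {Wp T : Finset ι} (hT : T ⊆ Wp) (hvlo0 : ∀ z ∈ Wp, z ≠ o → vlo z ≤ 0) :
    ∑ z ∈ Wp.erase o, vlo z ≤ ∑ z ∈ T.erase o, vlo z := by
  have hsub : T.erase o ⊆ Wp.erase o := Finset.erase_subset_erase o hT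
  rw [← Finset.sum_sdiff hsub]
  have hneg : ∑ z ∈ Wp.erase o \ T.erase o, vlo z ≤ 0 :=
    Finset.sum_nonpos fun z hz => by
      have hz' := (Finset.mem_sdiff.1 hz).1
      exact hvlo0 z (Finset.mem_of_mem_erase hz') (Finset.ne_of_mem_erase hz')
  linarith

/-- Refund monotonicity: with `kw ≥ 0`, the sum over `K` is dominated by the sum over any super-set. [folklore] -/
theorem sum_le_of_subset_of_nonneg {K T : Finset ι} (hT : K ⊆ T) (hkw0 : ∀ z ∈ T, 0 ≤ kw z) : ∑ z ∈ K, kw z ≤ ∑ z ∈ T, kw z :=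
  Finset.sum_le_sum_of_subset_of_nonneg hT fun z hz _ => hkw0 z hz

end Envelopes

/-! ## §2b. Normal boxes: the brackets `g_lo ≤ gram ≤ g_hi`, `N_lo ≤ ‖F n₁‖ ≤ N_hi` in closed form (for the K-file generator) -/

/-- ★ THE NORMAL BOX of a Z cell: label normals within `η` of the centre `c`, coordinatewise. -/
def normalBox (c η : Fin 3 → ℝ) : Set (Fin 3 → ℝ) := {n | ∀ i, |n i - c i| ≤ η i}

section NormalBox

variable {c η n v : Fin 3 → ℝ}

/-- Membership in the normal box. [folklore] -/
theorem mem_normalBox : n ∈ normalBox c η ↔ ∀ i, |n i - c i| ≤ η i := Iff.rfl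

/-- The centre is in its box (`η ≥ 0`). [folklore] -/
theorem center_mem_normalBox (hη : ∀ i, 0 ≤ η i) : c ∈ normalBox c η := fun i => by
  rw [sub_self, abs_zero]
  exact hη i

/-- Lower corner of a pairing over the box: `v·c − Σ|vᵢ|ηᵢ ≤ v·n`. [folklore] -/
theorem dot_box_lower (hn : n ∈ normalBox c η) : ∑ i, v i * c i - ∑ i, |v i| * η i ≤ ∑ i, v i * n i := by
  rw [← Finset.sum_sub_distrib]
  refine Finset.sum_le_sum fun i _ => ?_
  have h1 : -(|v i| * |n i - c i|) ≤ v i * (n i - c i) := by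
    rw [← abs_mul]
    exact neg_abs_le _
  have h2 : |v i| * |n i - c i| ≤ |v i| * η i := mul_le_mul_of_nonneg_left (hn i) (abs_nonneg _)
  linarith

/-- Upper corner: `v·n ≤ v·c + Σ|vᵢ|ηᵢ`. [folklore] -/
theorem dot_box_upper (hn : n ∈ normalBox c η) : ∑ i, v i * n i ≤ ∑ i, v i * c i + ∑ i, |v i| * η i := by
  rw [← Finset.sum_add_distrib]
  refine Finset.sum_le_sum fun i _ => ?_
  have h1 : v i * (n i - c i) ≤ |v i| * |n i - c i| := by
    rw [← abs_mul]
    exact le_abs_self _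
  have h2 : |v i| * |n i - c i| ≤ |v i| * η i := mul_le_mul_of_nonneg_left (hn i) (abs_nonneg _)
  linarith

/-- `Σ|nⱼ| ≤ Σ(|cⱼ| + ηⱼ)` on the box. [folklore] -/
theorem sum_abs_le_of_box (hn : n ∈ normalBox c η) : ∑ j, |n j| ≤ ∑ j, (|c j| + η j) :=
  Finset.sum_le_sum fun j _ => by
    have h1 : |n j| ≤ |c j| + |n j - c j| := by
      calc |n j| = |c j + (n j - c j)| := by rw [add_sub_cancel]
        _ ≤ |c j| + |n j - c j| := abs_add_le _ _
    linarith [hn j]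

/-- `Σ nⱼ² ≤ Σ(|cⱼ| + ηⱼ)²` on the box (for `N_hi` via `norm_posL_le_bracket`). [folklore] -/
theorem sum_sq_le_of_box (hn : n ∈ normalBox c η) : ∑ j, n j ^ 2 ≤ ∑ j, (|c j| + η j) ^ 2 :=
  Finset.sum_le_sum fun j _ => by
    have h1 : |n j| ≤ |c j| + η j := by
      calc |n j| = |c j + (n j - c j)| := by rw [add_sub_cancel]
        _ ≤ |c j| + |n j - c j| := abs_add_le _ _
        _ ≤ |c j| + η j := by linarith [hn j]
    have h2 : n j ^ 2 = |n j| ^ 2 := (sq_abs _).symm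
    rw [h2]
    exact pow_le_pow_left₀ (abs_nonneg _) h1 2

/-- `Σ(|cⱼ| − ηⱼ)² ≤ Σ nⱼ²` on the box when `ηⱼ ≤ |cⱼ|` (for `N_lo` via `gram_ge_nearId`). [folklore] -/
theorem sum_sq_ge_of_box (hn : n ∈ normalBox c η) (hcη : ∀ j, η j ≤ |c j|) : ∑ j, (|c j| - η j) ^ 2 ≤ ∑ j, n j ^ 2 :=
  Finset.sum_le_sum fun j _ => by
    have h1 : |c j| - η j ≤ |n j| := by
      have : |c j| ≤ |n j| + |n j - c j| := by
        calc |c j| = |n j - (n j - c j)| := by rw [sub_sub_cancel]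
          _ ≤ |n j| + |n j - c j| := abs_sub _ _
      linarith [hn j]
    have h2 : n j ^ 2 = |n j| ^ 2 := (sq_abs _).symm
    rw [h2]
    exact pow_le_pow_left₀ (sub_nonneg.2 (hcη j)) h1 2

/-- ★ `g_lo` IN CLOSED FORM: on the strain box `|G − 1| ≤ ε` and the normal box,
`v·c − Σ|vᵢ|ηᵢ − ε·Σ|vᵢ|·Σ(|cⱼ|+ηⱼ) ≤ gram G v n`. [folklore] -/
theorem gram_box_lower {G : Matrix (Fin 3) (Fin 3) ℝ} {ε : ℝ} (hG : ∀ i j, |G i j - (if i = j then 1 else 0)| ≤ ε) (hε : 0 ≤ ε)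
    (hn : n ∈ normalBox c η) :
    ∑ i, v i * c i - ∑ i, |v i| * η i - ε * ((∑ i, |v i|) * ∑ j, (|c j| + η j)) ≤ gram G v n := by
  have h1 := dot_sub_le_gram hG v n
  have h2 := dot_box_lower (v := v) hn
  have h3 : ε * ((∑ i, |v i|) * ∑ j, |n j|) ≤ ε * ((∑ i, |v i|) * ∑ j, (|c j| + η j)) :=
    mul_le_mul_of_nonneg_left (mul_le_mul_of_nonneg_left (sum_abs_le_of_box hn) (Finset.sum_nonneg fun i _ => abs_nonneg _)) hε
  linarith

/-- ★ `g_hi` IN CLOSED FORM: `gram G v n ≤ v·c + Σ|vᵢ|ηᵢ + ε·Σ|vᵢ|·Σ(|cⱼ|+ηⱼ)`. [folklore] -/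
theorem gram_box_upper {G : Matrix (Fin 3) (Fin 3) ℝ} {ε : ℝ} (hG : ∀ i j, |G i j - (if i = j then 1 else 0)| ≤ ε) (hε : 0 ≤ ε)
    (hn : n ∈ normalBox c η) :
    gram G v n ≤ ∑ i, v i * c i + ∑ i, |v i| * η i + ε * ((∑ i, |v i|) * ∑ j, (|c j| + η j)) := by
  have h1 := gram_le_dot_add hG v n
  have h2 := dot_box_upper (v := v) hn
  have h3 : ε * ((∑ i, |v i|) * ∑ j, |n j|) ≤ ε * ((∑ i, |v i|) * ∑ j, (|c j| + η j)) :=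
    mul_le_mul_of_nonneg_left (mul_le_mul_of_nonneg_left (sum_abs_le_of_box hn) (Finset.sum_nonneg fun i _ => abs_nonneg _)) hε
  linarith

/-- ★ THE NORMAL BRACKET on the boxes: `N_lo ≤ ‖F n₁‖ ≤ N_hi` from `(1+3ε)·Σ(|cⱼ|+ηⱼ)² ≤ N_hi²` and `N_lo² ≤ (1−3ε)·Σ(|cⱼ|−ηⱼ)²`
(`ε ≤ 1/3`, `ηⱼ ≤ |cⱼ|`, `N_lo, N_hi ≥ 0`). [folklore] -/
theorem norm_posL_box_bracket {F : Matrix (Fin 3) (Fin 3) ℝ} {ε Nlo Nhi : ℝ}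
    (hG : ∀ i j, |(F.transpose * F) i j - (if i = j then 1 else 0)| ≤ ε) (hε3 : 3 * ε ≤ 1) (hn : n ∈ normalBox c η)
    (hcη : ∀ j, η j ≤ |c j|) (hNlo : 0 ≤ Nlo) (hNhi : 0 ≤ Nhi) (hlo : Nlo ^ 2 ≤ (1 - 3 * ε) * ∑ j, (|c j| - η j) ^ 2)
    (hhi : (1 + 3 * ε) * ∑ j, (|c j| + η j) ^ 2 ≤ Nhi ^ 2) : Nlo ≤ ‖posL F n‖ ∧ ‖posL F n‖ ≤ Nhi := by
  have hε : 0 ≤ ε := le_trans (abs_nonneg _) (hG 0 0)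
  constructor
  · refine le_norm_posL F hNlo ((hlo.trans ?_).trans (gram_ge_nearId hG n))
    exact mul_le_mul_of_nonneg_left (sum_sq_ge_of_box hn hcη) (by linarith)
  · refine norm_posL_le_bracket F n hG hNhi ((mul_le_mul_of_nonneg_left (sum_sq_le_of_box hn) (by linarith)).trans hhi)

end NormalBox

end Summit.AtomisticToContinuum.Crystallization.Theorems.FrustratedLawDichotomyCellZFrame

end
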